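import Mathlib
import Summits.Ventures.HodgeRepro2.T5ConductorArithmetic
import Summits.Ventures.HodgeRepro2.T6N5TateTwist
import Summits.Ventures.HodgeRepro2.T6N5Hyp
import Summits.Ventures.HodgeRepro2.T6N5LocalDatum
import Summits.Ventures.HodgeRepro2.T6N5LocalHyp
import Summits.Ventures.HodgeRepro2.T6N5Local
import Summits.Ventures.HodgeRepro2.T6N5LocalCharDatum
import Summits.Ventures.HodgeRepro2.T6N5LocalRamHyp
import Summits.Ventures.HodgeRepro2.T6N5LocalRam

/-!
# T6N5LocalRamToy — the non-vacuity witness for `T6N5LocalRam` (README §10.5(ii)(c),(d))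

A ramified local sign datum on which EVERY binder of `N5LocalRam.N5Local_main_ramified` holds jointly:
`E = Multiplicative ℤ × (ℕ → ℤˣ)` («valuation × units») with the uniformiser `π = (1, 1)`, the filtration
`U n = {(0, f) | f i = 1 for i < n}` (`U 0` = the unit part), `F_v^× = ⟨π²⟩` (so «conjugate-dual» = trivial at
`π²`), Tate's carriers with `Psi = E` (`ψ_a = ψ·a`, `n(ψ)` = the valuation of `ψ`), `Meas = ℝ`,
`ε(χ, ψ, dx) = dx · χ(ψ) · χ(π)^{a(χ)}` — which satisfies (3.2.2)–(3.2.3), the conventions, Tate's (3.2.6.3)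
and Proposition 5.1 (2) at `ψ_δ = 1` — the unramified `μ = (−1)^{valuation}`, and the coordinate characters
`χ_i` of exact conductor `i + 1`. `toyRam_solution` applies `N5Local_main_ramified` to it.
README §8(d): uses an L-value-free non-vanishing device: NO.
-/

namespace Summit.Ventures.HodgeRepro2.T6.N5LocalRamToy

open Summit.Ventures.HodgeRepro2.T6.N5LocalDatum Summit.Ventures.HodgeRepro2.T6.N5TateTwist
  Summit.Ventures.HodgeRepro2.T5ConductorArithmetic Summit.Ventures.HodgeRepro2.T6.N5LocalCharDatum
  Summit.Ventures.HodgeRepro2.T6.N5LocalCharDatum.CharDatum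
  Summit.Ventures.HodgeRepro2.T6.N5LocalRamDatum
  Summit.Ventures.HodgeRepro2.T6.N5Local Summit.Ventures.HodgeRepro2.T6.N5LocalRam
  Summit.Ventures.HodgeRepro2.T6.Hyp

noncomputable section

/-- The unit part `ℕ → ℤˣ`. -/
abbrev ToyUnits : Type := ℕ → ℤˣ

/-- The toy group `E = Multiplicative ℤ × (ℕ → ℤˣ)`: valuation × units. -/
abbrev ToyE : Type := Multiplicative ℤ × ToyUnits

/-- The filtration on the unit part: `f i = 1` for all `i < n`. -/
def toyUU (n : ℕ) : Subgroup ToyUnits := Subgroup.pi (Set.Iio n) (fun _ => ⊥)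

/-- Membership in the unit-part filtration. -/
theorem mem_toyUU {n : ℕ} {f : ToyUnits} : f ∈ toyUU n ↔ ∀ i, i < n → f i = 1 := by
  simp [toyUU, Subgroup.mem_pi]

/-- The toy filtration `U n = {(0, f) | f ∈ toyUU n}`. -/
def toyU (n : ℕ) : Subgroup ToyE := (⊥ : Subgroup (Multiplicative ℤ)).prod (toyUU n)

/-- Membership in the toy filtration: valuation `0` and the first `n` coordinates trivial. -/
theorem mem_toyU {n : ℕ} {x : ToyE} : x ∈ toyU n ↔ x.1 = 1 ∧ ∀ i, i < n → x.2 i = 1 := by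
  simp only [toyU, Subgroup.mem_prod, Subgroup.mem_bot, mem_toyUU]

/-- The toy filtration is antitone. -/
theorem toyU_antitone : Antitone toyU := by
  intro m n hmn x hx
  rw [mem_toyU] at hx ⊢
  exact ⟨hx.1, fun i hi => hx.2 i (lt_of_lt_of_le hi hmn)⟩

/-- The uniformiser `π = (1, 1)` (valuation one, trivial unit part). -/
def toyπ : ToyE := (Multiplicative.ofAdd 1, 1)

/-- Every element is `(valuation, 1) · (1, unit)`. -/
theorem eq_inl_mul_inr (x : ToyE) : x = (x.1, 1) * (1, x.2) := by
  ext <;> simp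

/-- The value of a character on the valuation part: `ξ (z, 1) = ξ(π)^{z}`. -/
theorem apply_inl (ξ : ToyE →* ℂˣ) (z : Multiplicative ℤ) :
    ξ (z, 1) = ξ toyπ ^ (Multiplicative.toAdd z) := by
  have hz : (z, (1 : ToyUnits)) = (MonoidHom.inl (Multiplicative ℤ) ToyUnits) z := rfl
  have hπ : toyπ = (MonoidHom.inl (Multiplicative ℤ) ToyUnits) (Multiplicative.ofAdd 1) := rfl
  rw [hz, hπ, ← MonoidHom.comp_apply, ← MonoidHom.comp_apply, ← map_zpow, ← ofAdd_zsmul, smul_eq_mul,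
    mul_one, ofAdd_toAdd]

/-- The unit part of any element lies in `U 0`. -/
theorem unit_mem_toyU_zero (x : ToyE) : ((1 : Multiplicative ℤ), x.2) ∈ toyU 0 := by
  rw [mem_toyU]
  exact ⟨rfl, fun i hi => absurd hi (Nat.not_lt_zero i)⟩

/-- The inclusion `ℤˣ →* ℂˣ`. -/
def toyInc : ℤˣ →* ℂˣ := Units.map (Int.castRingHom ℂ).toMonoidHom

/-- The inclusion `ℤˣ →* ℂˣ` is non-trivial at `−1`. -/
theorem toyInc_neg_one : toyInc (-1) ≠ 1 := by
  intro h
  have h' : ((toyInc (-1) : ℂˣ) : ℂ) = 1 := by rw [h]; rfl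
  simp [toyInc] at h'
  norm_num at h'

/-- The coordinate character `χ_i : (z, f) ↦ f i`. -/
def toyChar (i : ℕ) : ToyE →* ℂˣ :=
  toyInc.comp ((Pi.evalMonoidHom (fun _ => ℤˣ) i).comp (MonoidHom.snd (Multiplicative ℤ) ToyUnits))

/-- Evaluation of the coordinate character. -/
theorem toyChar_apply (i : ℕ) (x : ToyE) : toyChar i x = toyInc (x.2 i) := rfl

/-- The unramified character `μ : (z, f) ↦ (−1)^z`. -/
def toyμ : ToyE →* ℂˣ := (zpowersHom ℂˣ (-1)).comp (MonoidHom.fst (Multiplicative ℤ) ToyUnits)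

/-- Evaluation of the unramified character `μ`. -/
theorem toyμ_apply (x : ToyE) : toyμ x = (-1 : ℂˣ) ^ (Multiplicative.toAdd x.1) := rfl

/-- The toy ε-factor: `ε(χ, ψ, dx) = dx · χ(ψ) · χ(π)^{a(χ)}`. -/
def toyEps (χ : ToyE →* ℂˣ) (ψ : ToyE) (dx : ℝ) : ℂ :=
  (dx : ℂ) * ((χ ψ : ℂˣ) : ℂ) * ((χ toyπ : ℂˣ) : ℂ) ^ (conductor toyU χ)

/-- The sign of the toy root number at `ψ_δ = 1` with the self-dual measure `1`. -/
def toyEpsSign (ξ : ToyE →* ℂˣ) : ℤˣ := toSign (toyEps (ξ * 1) 1 1)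

/-- The toy datum. -/
abbrev toy : RamifiedSignDatum where
  E := ToyE
  U := toyU
  Fsub := Subgroup.zpowers (toyπ * toyπ)
  η := 1
  Psi := ToyE
  Meas := ℝ
  omega := fun _ => 1
  nrm := fun _ => 1
  tw := fun ψ a => ψ * a
  sc := fun r dx => r * dx
  sd := fun _ => 1
  epsT := toyEps
  ψδ := 1
  χW := 1
  epsdW := 1
  Theta := fun s α => toyEpsSign ((1 : ToyE →* ℂˣ)⁻¹ * α) = s * 1
  ηLine := fun _ => 1
  ηu := -1
  π := toyπ
  n := fun ψ => Multiplicative.toAdd ψ.1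
  IsConjInv := fun ψ => ψ = 1

/-- `ξ · 1 = ξ` for the toy characters (pointwise). -/
theorem toy_mul_one (ξ : ToyE →* ℂˣ) : ξ * (1 : ToyE →* ℂˣ) = ξ := by
  ext x
  simp

/-- `1⁻¹ · α = α` for the toy characters (pointwise). -/
theorem toy_inv_one_mul (α : ToyE →* ℂˣ) : (1 : ToyE →* ℂˣ)⁻¹ * α = α := by
  ext x
  simp

/-! ### Conductors of the toy characters -/

/-- The trivial character has conductor `0` on the toy. -/
theorem toy_cond_one : conductor toyU (1 : ToyE →* ℂˣ) = 0 :=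
  Nat.le_zero.mp (conductor_le_of_le_ker (fun f _ => by simp))

/-- `μ` has conductor `0` (it is trivial on `U 0`). -/
theorem toy_cond_μ : conductor toyU toyμ = 0 := by
  refine Nat.le_zero.mp (conductor_le_of_le_ker (fun x hx => ?_))
  rw [MonoidHom.mem_ker, toyμ_apply, (mem_toyU.mp hx).1]
  simp

/-- The coordinate character `χ_{n−1}` has exact conductor `n` (`n ≥ 1`). -/
theorem toy_cond_char (n : ℕ) (hn : 1 ≤ n) : conductor toyU (toyChar (n - 1)) = n := by
  have hle : toyU n ≤ (toyChar (n - 1)).ker := fun x hx => by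
    rw [MonoidHom.mem_ker, toyChar_apply, (mem_toyU.mp hx).2 (n - 1) (by omega), map_one]
  have hnle : ¬ toyU (n - 1) ≤ (toyChar (n - 1)).ker := by
    intro h
    have hmem : ((1 : Multiplicative ℤ), Pi.mulSingle (n - 1) (-1 : ℤˣ)) ∈ toyU (n - 1) := by
      rw [mem_toyU]
      exact ⟨rfl, fun i hi => Pi.mulSingle_eq_of_ne (by omega) _⟩
    have := h hmem
    rw [MonoidHom.mem_ker, toyChar_apply] at this
    dsimp only at this
    rw [Pi.mulSingle_eq_same] at this
    exact toyInc_neg_one this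
  have h1 : conductor toyU (toyChar (n - 1)) ≤ n := conductor_le_of_le_ker hle
  have h2 : ¬ conductor toyU (toyChar (n - 1)) ≤ n - 1 := fun h =>
    hnle (le_ker_of_conductor_le toyU_antitone ⟨n, hle⟩ h)
  omega

/-- The coordinate character `χ_{n−1}` is smooth. -/
theorem toy_isSmooth_char (n : ℕ) (hn : 1 ≤ n) : toy.IsSmooth (toyChar (n - 1)) :=
  ⟨n, fun x hx => by
    rw [MonoidHom.mem_ker, toyChar_apply, (mem_toyU.mp hx).2 (n - 1) (by omega), map_one]⟩

/-! ### The restriction conditions on the toy: «conjugate-dual» = trivial at `π²` -/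

/-- `ξ` is conjugate-orthogonal on the toy iff `ξ(π²) = 1`. -/
theorem toy_isCO_iff (ξ : ToyE →* ℂˣ) : toy.toLocalSignDatum.IsCO ξ ↔ ξ (toyπ * toyπ) = 1 := by
  rw [isCO_iff toy.toCharDatum]
  constructor
  · intro h
    exact h ⟨toyπ * toyπ, Subgroup.mem_zpowers _⟩
  · intro h x
    obtain ⟨k, hk⟩ := Subgroup.mem_zpowers_iff.mp x.2
    change ξ (x : ToyE) = 1
    rw [← hk, map_zpow, h, one_zpow]

/-- On the toy (`η_v = 1`) conjugate-symplectic = conjugate-orthogonal. -/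
theorem toy_isCS_iff (ξ : ToyE →* ℂˣ) : toy.toLocalSignDatum.IsCS ξ ↔ ξ (toyπ * toyπ) = 1 := by
  rw [← toy_isCO_iff]
  rw [isCS_iff toy.toCharDatum, isCO_iff toy.toCharDatum]
  simp only [MonoidHom.one_apply]

/-- The coordinate characters are trivial at `π` (its unit part is trivial). -/
theorem toyChar_π (i : ℕ) : toyChar i toyπ = 1 := by
  rw [toyChar_apply]
  simp [toyπ]

/-- The coordinate characters are conjugate-orthogonal on the toy. -/
theorem toy_char_isCO (i : ℕ) : toy.toLocalSignDatum.IsCO (toyChar i) := by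
  rw [toy_isCO_iff, map_mul, toyChar_π, mul_one]

/-- The coordinate characters are conjugate-symplectic on the toy (`η_v = 1`). -/
theorem toy_char_isCS (i : ℕ) : toy.toLocalSignDatum.IsCS (toyChar i) := by
  rw [toy_isCS_iff, map_mul, toyChar_π, mul_one]

/-- `μ(π) = −1`. -/
theorem toyμ_π : toyμ toyπ = -1 := by
  rw [toyμ_apply]
  simp [toyπ]

/-- `μ` is conjugate-orthogonal on the toy (`μ(π²) = 1`). -/
theorem toyμ_isCO : toy.toLocalSignDatum.IsCO toyμ := by
  rw [toy_isCO_iff, map_mul, toyμ_π]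
  simp

/-- `μ² = 1`. -/
theorem toyμ_sq : toyμ * toyμ = 1 := by
  ext x
  rw [MonoidHom.mul_apply, toyμ_apply, MonoidHom.one_apply, ← zpow_add, Units.val_zpow_eq_zpow_val]
  simp only [Units.val_neg, Units.val_one, Units.val_one]
  rw [← two_mul, zpow_mul]
  norm_num

/-! ### The displays and conventions on the toy -/

/-- The normalisation conventions hold on the toy (`‖·‖ = 1`, `ω_s = 1`, `dx_ψ = 1`). -/
theorem toy_conventions : toy.toCharDatum.Conventions where
  ev_omega := fun s a => by
    show ((1 : ℂˣ) : ℂ) = ((1 : ℝ) : ℂ) ^ s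
    simp
  nrm_pos := fun _ => by show (0 : ℝ) < 1; norm_num
  sd_tw := fun ψ a => by
    show (1 : ℝ) = Real.sqrt 1 * 1
    simp

/-- Tate's (3.2.2)–(3.2.3) hold for the toy ε-factor. -/
theorem toy_tate : Tate1979_3_2_2_3 toy.epsT (fun ξ a => ((ξ a : ℂˣ) : ℂ)) toy.tw toy.sc toy.nrm
    (fun _ => True) := by
  refine ⟨fun χ ψ dx r _ => ?_, fun χ ψ dx a _ => ?_⟩
  · show toyEps χ ψ (r * dx) = r * toyEps χ ψ dx
    unfold toyEps
    push_cast
    ring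
  · show toyEps χ (ψ * a) dx = ((χ a : ℂˣ) : ℂ) * ((1 : ℝ) : ℂ)⁻¹ * toyEps χ ψ dx
    unfold toyEps
    rw [map_mul, Units.val_mul]
    push_cast
    ring

/-- An unramified character of the toy is `ω(π)^{valuation}`. -/
theorem toy_unramified_apply {ω : ToyE →* ℂˣ} (h0 : toy.IsUnramified ω) (ψ : ToyE) :
    ω ψ = ω toyπ ^ (Multiplicative.toAdd ψ.1) := by
  have hu : ω ((1 : Multiplicative ℤ), ψ.2) = 1 := MonoidHom.mem_ker.mp (h0 (unit_mem_toyU_zero ψ))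
  conv_lhs => rw [eq_inl_mul_inr ψ]
  rw [map_mul, hu, mul_one, apply_inl]

/-- The value of an unramified character at a power of `π`. -/
theorem toy_unramified_zpow {ω : ToyE →* ℂˣ} (_h0 : toy.IsUnramified ω) (k : ℤ) :
    ω (toyπ ^ k) = ω toyπ ^ k :=
  map_zpow ω toyπ k

/-- Tate's (3.2.6.3) holds for the toy ε-factor. -/
theorem toy_T6 : Tate1979_3_2_6_3 toy := by
  intro χ ω ψ dx hχ hω
  show toyEps (χ * ω) ψ dx = toyEps χ ψ dx * ((ω (toyπ ^ (Multiplicative.toAdd ψ.1 + (conductor toyU χ : ℤ))) : ℂˣ) : ℂ)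
  have hcond : conductor toyU (χ * ω) = conductor toyU χ :=
    cond_mul_of_isUnramified toy.toCharDatum toyU_antitone hχ hω
  unfold toyEps
  rw [hcond, MonoidHom.mul_apply, MonoidHom.mul_apply, toy_unramified_apply hω ψ, toy_unramified_zpow hω,
    zpow_add, zpow_natCast]
  simp only [Units.val_mul, Units.val_zpow_eq_zpow_val, Units.val_pow_eq_pow_val]
  ring

/-- The toy root number at `ψ = 1`: `ε(½, ξ, 1) = ξ(π)^{a(ξ)}`. -/
theorem toy_epsS_one (ξ : ToyE →* ℂˣ) :
    toy.tate.epsS (1 / 2) ξ 1 = ((ξ toyπ : ℂˣ) : ℂ) ^ conductor toyU ξ := by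
  show toyEps (ξ * 1) 1 1 = _
  rw [toy_mul_one]
  unfold toyEps
  rw [map_one, Units.val_one]
  push_cast
  ring

/-- Proposition 5.1 (2) holds on the toy at `ψ_δ = 1`: the root number of a character trivial at `π²` is `±1`. -/
theorem toy_G51 : GGP2012_Prop5_1_2 toy := by
  intro ψ hψ ξ hξ _
  have hψ' : ψ = 1 := hψ
  subst hψ'
  have hξπ : ξ (toyπ * toyπ) = 1 := by
    rcases hξ with h | h
    · exact (toy_isCS_iff ξ).mp h
    · exact (toy_isCO_iff ξ).mp h
  have h2 : ((ξ toyπ : ℂˣ) : ℂ) ^ 2 = 1 := by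
    rw [map_mul] at hξπ
    have := congrArg (fun u : ℂˣ => (u : ℂ)) hξπ
    simpa [sq] using this
  rw [toy_epsS_one, ← pow_mul, mul_comm, pow_mul, h2, one_pow]

/-! ### The datum conditions on the toy -/

/-- `ω_{1/2} = 1` is unramified on the toy. -/
theorem toy_hω : toy.IsUnramified (toy.omega (1 / 2)) := fun x _ => by
  show x ∈ (1 : ToyE →* ℂˣ).ker
  simp

/-- `μ` is unramified (trivial on `U 0`). -/
theorem toyμ_isUnramified : toy.IsUnramified toyμ := fun x hx => by
  rw [MonoidHom.mem_ker, toyμ_apply, (mem_toyU.mp hx).1]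
  simp

/-- The datum condition `hμ` on the toy: `μ` is conjugate-orthogonal, unramified, `μ(π) = −1`, `μ² = 1`. -/
theorem toy_hμ : ∃ μ : ToyE →* ℂˣ, toy.toLocalSignDatum.IsCO μ ∧ toy.IsUnramified μ ∧
    ((μ toyπ : ℂˣ) : ℂ) = -1 ∧ μ * μ = 1 :=
  ⟨toyμ, toyμ_isCO, toyμ_isUnramified, by rw [toyμ_π, Units.val_neg, Units.val_one], toyμ_sq⟩

/-- The coordinate character `χ_0` has conductor `1`. -/
theorem toy_cond_char_zero : conductor toyU (toyChar 0) = 1 := by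
  have h := toy_cond_char 1 le_rfl
  simpa using h

/-- The datum condition `hodd` on the toy: `χ_0` is conjugate-symplectic of odd conductor `1`. -/
theorem toy_hodd : ∃ ωt : ToyE →* ℂˣ, toy.toLocalSignDatum.IsCS ωt ∧ toy.IsSmooth ωt ∧
    Odd (toy.cond ωt) :=
  ⟨toyChar 0, toy_char_isCS 0, toy_isSmooth_char 1 le_rfl, by
    change Odd (conductor toyU (toyChar 0))
    rw [toy_cond_char_zero]
    exact odd_one⟩

/-- The datum condition `heven` on the toy: `χ_{2k+1}` is conjugate-orthogonal of even conductor `2k+2 > k`. -/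
theorem toy_heven : ∀ k : ℕ, ∃ β : ToyE →* ℂˣ, toy.toLocalSignDatum.IsCO β ∧ toy.IsSmooth β ∧
    Even (toy.cond β) ∧ k < toy.cond β := by
  intro k
  have hc : conductor toyU (toyChar (2 * k + 1)) = 2 * k + 2 := by
    have := toy_cond_char (2 * k + 2) (by omega)
    simpa using this
  refine ⟨toyChar (2 * k + 1), toy_char_isCO _, ?_, ?_, ?_⟩
  · have := toy_isSmooth_char (2 * k + 2) (by omega)
    simpa using this
  · show Even (conductor toyU (toyChar (2 * k + 1)))
    rw [hc]
    exact ⟨k + 1, by ring⟩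
  · show k < conductor toyU (toyChar (2 * k + 1))
    rw [hc]
    omega

/-- The toy root-number sign: `ε_v(ξ) = toSign (ξ(π)^{a(ξ)})`. -/
theorem toyEpsSign_eq (ξ : ToyE →* ℂˣ) : toyEpsSign ξ = toSign (((ξ toyπ : ℂˣ) : ℂ) ^ conductor toyU ξ) := by
  unfold toyEpsSign toyEps
  rw [toy_mul_one, map_one, Units.val_one]
  congr 1
  push_cast
  ring

/-- (A1) on the toy: `α = 1` for `s = +1`, `α = μ χ_0` for `s = −1`. -/
theorem toy_hA1 : ∀ s : ℤˣ, ∃ α : ToyE →* ℂˣ, toy.toLocalSignDatum.IsCO α ∧ toy.toLocalSignDatum.Theta s α := by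
  intro s
  rcases Int.units_eq_one_or s with hs | hs
  · refine ⟨1, (toy_isCO_iff 1).mpr (by simp), ?_⟩
    show toyEpsSign ((1 : ToyE →* ℂˣ)⁻¹ * 1) = s * 1
    rw [toy_inv_one_mul, toyEpsSign_eq, toy_cond_one, hs, mul_one]
    simp [toSign]
  · refine ⟨toyChar 0 * toyμ, ?_, ?_⟩
    · rw [toy_isCO_iff, MonoidHom.mul_apply, (toy_isCO_iff toyμ).mp toyμ_isCO,
        (toy_isCO_iff (toyChar 0)).mp (toy_char_isCO 0), mul_one]
    · show toyEpsSign ((1 : ToyE →* ℂˣ)⁻¹ * (toyChar 0 * toyμ)) = s * 1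
      have hcond : conductor toyU (toyChar 0 * toyμ) = 1 := by
        have h : conductor toyU (toyChar 0 * toyμ) = conductor toyU (toyChar 0) :=
          cond_mul_of_isUnramified toy.toCharDatum toyU_antitone (toy_isSmooth_char 1 le_rfl)
            toyμ_isUnramified
        rw [h, toy_cond_char_zero]
      rw [toy_inv_one_mul, toyEpsSign_eq, hcond, hs, mul_one, MonoidHom.mul_apply, toyμ_π, toyChar_π,
        one_mul, pow_one, Units.val_neg, Units.val_one]
      simp only [toSign]
      rw [if_neg]
      norm_num

/-- The Epsilon Dichotomy display holds on the toy (the theta predicate is defined as its right side). -/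
theorem toy_h35 : BFGYYZ2025_Thm3_5 toy.toLocalSignDatum := fun _ _ _ => Iff.rfl

/-- EVERY binder of `N5Local_main_ramified` holds on the toy, and the coupled local system is solved there
(README §10.5(ii)(c),(d) for `T6N5LocalRam`). -/
theorem toyRam_solution : ∃ ξ : Fin 4 → ToyE →* ℂˣ, LocalSolution toy.toLocalSignDatum ξ :=
  N5Local_main_ramified toy toy_T6 toy_G51 toyU_antitone toy_hω rfl toy_hμ toy_hodd toy_heven toy_h35
    toy_hA1 rfl (by ext x; simp) ((toy_isCS_iff 1).mpr (by simp))

end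

end Summit.Ventures.HodgeRepro2.T6.N5LocalRamToy
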